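import Literature.NumberTheory.LFunctions.MultiplicativeAutomaticProofs
import Literature.NumberTheory.LFunctions.ElliottKishRigidity
import Literature.NumberTheory.LFunctions.ElliottKishExactness
import Literature.NumberTheory.LFunctions.TaoLogElliottHolds
import HarnessLib

/-!
# Klurman–Kurlberg 2019, Theorem 1.3 — PROVED unconditionally (the named fact
`KlurmanKurlberg2019_thm13` discharged)

Topic `Literature/NumberTheory/LFunctions`. Everything in this file is PROVED; no definitions, no
named facts. It discharges the named fact `Literature.NumberTheory.LFunctions.KlurmanKurlberg2019_thm13`
(`MultiplicativeAutomatic.lean`: a completely multiplicative `q`-automatic `f : ℕ → ℂ` is either a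
Dirichlet character on the integers coprime to some `Q`, or vanishes at all large primes) along
the printed proof:

* the SPARSE half [KK, Prop 2.4] and the two-case assembly are proved in
  `MultiplicativeAutomaticProofs` (`KlurmanKurlberg2019_prop24'`, `KlurmanKurlberg2019_thm13_of_prop21`);
* the DENSE half [KK, Prop 2.1] is "pigeonhole in the kernel + Elliott–Kish 2017, Theorem 2".
  Elliott–Kish's theorem is needed only for the stripped function `g`, which is completely
  multiplicative, unimodular and OF FINITE ORDER (the range of `f` is finite); for such `g` it is
  proved here (`ElliottKish2017_thm2_finiteOrder`) from Steps 2–3 of the printed proof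
  (`ElliottKishRigidity`: Tao 2016 Thm 1.3 + the `k`-trick + `ζ` near `1` give a character `χ₀`
  at bounded pretentious distance; `ElliottKishExactness`: an eratosthenian sieve gives
  `g(p) = χ₀(p)` for `p ∤ q₀ a A`), Tao's theorem being the tree's
  `tao_log_averaged_elliott_two_holds` (proved from the Matomäki–Radziwiłł–Tao chain and a
  Vinogradov–Korobov region, `TaoLogElliottHolds`).

## Contents
* `ElliottKish2017_thm2_finiteOrder` — [EK] Theorem 2 for finite-order `g`, `b = B = 1`, `c = 1`,
  existential modulus (`Q = q₀ a A`), granted `tao_log_averaged_elliott_two`.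
* `exists_pow_eq_one_of_ne_zero` — uniform finite order `f(x)^{K!} = 1` of the nonzero values of a
  completely multiplicative sequence with finite `q`-kernel.
* `KlurmanKurlberg2019_prop21_of_finiteOrderEK` — [KK] Prop 2.1 from the finite-order Elliott–Kish
  statement (the proof of `KlurmanKurlberg2019_prop21_of_ElliottKish` verbatim, plus the finite
  order of the stripped `g`).
* `KlurmanKurlberg2019_prop21` — the dense half, unconditionally.
* `KlurmanKurlberg2019_thm13_holds : KlurmanKurlberg2019_thm13` — axioms `propext`,
  `Classical.choice`, `Quot.sound` only.

## References
* [KK] O. Klurman, P. Kurlberg, *A note on multiplicative automatic sequences*, C. R. Math. 357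
  (2019) 752–755 = arXiv:1904.04337, Thm 1.3, Props 2.1 and 2.4 (held text
  `paper:arxiv-1904.04337`, pp. 1–5). [KlurmanKurlberg2019]
* [EK] P. D. T. A. Elliott, J. Kish, Mathematika 63 (2017) 919–943, Theorem 2, §2 (held text
  `paper:doi-10-1112-s0025579317000304`, pp. 3, 5–10). [ElliottKish2017]
* T. Tao, Forum Math. Pi 4 (2016) e8, Theorem 1.3. [TaoFMP2016]

## Design choices
* A separate `…Holds` file (like `TaoLogElliottHolds`) so that `MultiplicativeAutomaticProofs`
  (elementary, light imports) does not acquire the analytic import chain.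
* `KlurmanKurlberg2019_prop21_of_finiteOrderEK` repeats the stripping argument of
  `KlurmanKurlberg2019_prop21_of_ElliottKish` rather than weakening that theorem's hypothesis in
  place (the accepted file is append-only and its statement is referenced).
* NOT here: Elliott–Kish's Theorem 2 without the finite-order hypothesis (its Step 1 rests on
  Elliott's characterisation of additive functions with `f(an+b) - f(An+B)` constant), the
  quantitative modulus `6(a,A)(aA)²Δ³` (Step 4), the general multiplicative classification of
  Konieczny–Lemańczyk–Müllner.
-/

namespace Literature.NumberTheory.LFunctions

open Finset
open scoped ComplexConjugate

section DenseUnconditional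

variable {q : ℕ} {f : ℕ → ℂ}

/-- **Elliott–Kish 2017, Theorem 2, for finite-order functions** (special case `b = B = 1`,
`c = 1`, existential modulus), granted Tao 2016, Theorem 1.3: a completely multiplicative
`g : ℕ → ℂ`, unimodular on the positive integers and of finite order (`g^m = 1`), with
`g(an+1) = g(An+1)` for all `n ≥ 1` (`a ≠ A` positive), coincides with a Dirichlet character on
all primes not dividing some modulus `Q` (here `Q = q₀ a A`). Steps 2–3 of the printed proof
(`ElliottKish2017.exists_char_pretentiousDistSq_le`, `ElliottKish2017.apply_eq_char_of_pretentiousDistSq_le`);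
Step 1 (finite order, Elliott's book Ch. 13) is the hypothesis, Step 4 (the modulus divides
`6(a,A)(aA)²Δ³`) is not needed for the existential statement.
[cite: ElliottKish2017, Theorem 2 (§2, Steps 2–3)] -/
theorem ElliottKish2017_thm2_finiteOrder (hE : tao_log_averaged_elliott_two) :
    ∀ a A : ℕ, 0 < a → 0 < A → a ≠ A → ∀ g : ℕ → ℂ,
      (∀ m n : ℕ, 1 ≤ m → 1 ≤ n → g (m * n) = g m * g n) → (∀ n : ℕ, 1 ≤ n → ‖g n‖ = 1) →
      (∃ m : ℕ, 0 < m ∧ ∀ n : ℕ, 1 ≤ n → g n ^ m = 1) →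
      (∀ n : ℕ, 1 ≤ n → g (a * n + 1) = g (A * n + 1)) →
        ∃ Q : ℕ, 0 < Q ∧ ∃ χ : DirichletCharacter ℂ Q, ∀ p : ℕ, p.Prime → ¬ p ∣ Q → g p = χ p := by
  classical
  intro a A ha hA haA g hg hgu hfin hrel
  obtain ⟨m, hm, hpow⟩ := hfin
  -- the arithmetic function `G` extending `g` by `G 0 = 0`
  let G : ArithmeticFunction ℂ := ⟨fun n => if n = 0 then 0 else g n, if_pos rfl⟩
  have hG : ∀ n : ℕ, 1 ≤ n → G n = g n := fun n hn => if_neg (by omega)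
  have hg1 : g 1 = 1 := ElliottKish2017.cm_one hg hgu
  have hGm : G.IsMultiplicative := by
    refine ⟨by rw [hG 1 le_rfl, hg1], fun {m n} _ => ?_⟩
    rcases Nat.eq_zero_or_pos m with rfl | hm0
    · simp
    rcases Nat.eq_zero_or_pos n with rfl | hn0
    · simp
    rw [hG _ (Nat.mul_pos hm0 hn0), hG _ hm0, hG _ hn0, hg _ _ hm0 hn0]
  have hGb : ∀ n : ℕ, ‖G n‖ ≤ 1 := fun n => by
    rcases Nat.eq_zero_or_pos n with rfl | hn
    · simp
    · rw [hG n hn, hgu n hn]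
  have hGu : ∀ n : ℕ, 1 ≤ n → ‖G n‖ = 1 := fun n hn => by rw [hG n hn, hgu n hn]
  have hGpow : ∀ p : ℕ, p.Prime → G p ^ m = 1 := fun p hp => by rw [hG p hp.pos, hpow p hp.pos]
  have hGrel : ∀ n : ℕ, 1 ≤ n → G (a * n + 1) = G (A * n + 1) := fun n hn => by
    rw [hG _ (Nat.succ_pos _), hG _ (Nat.succ_pos _), hrel n hn]
  obtain ⟨q₀, hq₀, χ₀, R, hR⟩ :=
    ElliottKish2017.exists_char_pretentiousDistSq_le hE ha hA haA G hGm hGb hGu hm hGpow hGrel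
  have hR' : ∀ x : ℝ, Sieve.pretentiousDistSq g (fun n => χ₀ n) x ≤ R := fun x => by
    have : Sieve.pretentiousDistSq g (fun n => χ₀ n) x
        = Sieve.pretentiousDistSq (⇑G) (fun n => χ₀ n) x := by
      unfold Sieve.pretentiousDistSq
      refine Finset.sum_congr rfl fun p hp => ?_
      rw [hG p (Nat.mem_primesLE.1 hp).2.pos]
    rw [this]
    exact hR x
  have hdvd : q₀ ∣ q₀ * (a * A) := dvd_mul_right q₀ _
  refine ⟨q₀ * (a * A), Nat.mul_pos hq₀ (Nat.mul_pos ha hA),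
    DirichletCharacter.changeLevel hdvd χ₀, fun p hp hpQ => ?_⟩
  have hpq : ¬ p ∣ q₀ := fun h => hpQ (h.trans hdvd)
  have hpa : ¬ p ∣ a := fun h => hpQ (h.trans ⟨q₀ * A, by ring⟩)
  have hpA : ¬ p ∣ A := fun h => hpQ (h.trans ⟨q₀ * a, by ring⟩)
  rw [ElliottKish2017.apply_eq_char_of_pretentiousDistSq_le hg hgu hm hpow ha hA haA hrel hq₀ χ₀
    hR' hp hpq hpa hpA]
  have hcop : Nat.Coprime p (q₀ * (a * A)) := (Nat.Prime.coprime_iff_not_dvd hp).2 hpQ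
  have hcopZ : IsCoprime (p : ℤ) ((q₀ * (a * A) : ℕ) : ℤ) := Nat.isCoprime_iff_coprime.mpr hcop
  have h := DirichletCharacter.changeLevel_eq_cast_of_dvd' χ₀ hdvd hcopZ
  simp only [Int.cast_natCast] at h
  exact h.symm

/-- A completely multiplicative sequence with finite `q`-kernel (`q ≥ 2`) has a UNIFORM finite
order on its nonzero values: there is `N ≥ 1` with `f(x)^N = 1` whenever `f(x) ≠ 0` (the range is
finite, so each nonzero value is a root of unity of order at most the size `K` of the range; take
`N = K!`). ([KK, §2, first remark]: "the image of `f` is finite and therefore … `f(p) = 0` or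
`f(p)` is a root of unity".) [cite: KlurmanKurlberg2019, §2] -/
theorem exists_pow_eq_one_of_ne_zero (hq : 2 ≤ q) (hf : ∀ m n : ℕ, f (m * n) = f m * f n)
    (hA : IsAutomaticSeq q f) :
    ∃ N : ℕ, 0 < N ∧ ∀ x : ℕ, f x ≠ 0 → f x ^ N = 1 := by
  classical
  have hK : (qKernel q f).Finite := hA
  have hvals : (Set.range f).Finite := by
    have hsub : Set.range f ⊆ (fun g : ℕ → ℂ => g 0) '' (qKernel q f) := by
      rintro _ ⟨m, rfl⟩
      refine ⟨fun n => f (q ^ (m + 1) * n + m), ⟨m + 1, by omega, m, ?_, rfl⟩, by simp⟩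
      calc m < 2 ^ m := Nat.lt_two_pow_self
        _ ≤ 2 ^ (m + 1) := Nat.pow_le_pow_right (by norm_num) (by omega)
        _ ≤ q ^ (m + 1) := Nat.pow_le_pow_left hq _
    exact (hK.image _).subset hsub
  set K : ℕ := hvals.toFinset.card with hKdef
  refine ⟨K.factorial, Nat.factorial_pos K, fun x hx => ?_⟩
  have h1 : f 1 = 1 := cm_map_one hf hx
  obtain ⟨j₁, hj₁, j₂, hj₂, hne, hjeq⟩ := Finset.exists_ne_map_eq_of_card_lt_of_maps_to
    (s := Finset.range (K + 1)) (t := hvals.toFinset) (f := fun j : ℕ => f x ^ j)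
    (by rw [Finset.card_range]; omega)
    (fun j _ => (Set.Finite.mem_toFinset hvals).2 ⟨x ^ j, cm_map_pow hf h1 x j⟩)
  -- WLOG `j₁ < j₂`
  have key : ∀ {i j : ℕ}, i < j → j ≤ K → f x ^ i = f x ^ j → f x ^ K.factorial = 1 := by
    intro i j hij hjK hfx
    have hpow : f x ^ (j - i) = 1 := by
      have h : f x ^ i * f x ^ (j - i) = f x ^ i * 1 := by
        rw [← pow_add, Nat.add_sub_cancel' hij.le, mul_one]
        exact hfx.symm
      exact mul_left_cancel₀ (pow_ne_zero _ hx) h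
    obtain ⟨c, hc⟩ := Nat.dvd_factorial (Nat.sub_pos_of_lt hij) (by omega : j - i ≤ K)
    rw [hc, pow_mul, hpow, one_pow]
  have hj₁K : j₁ ≤ K := Nat.lt_succ_iff.1 (Finset.mem_range.1 hj₁)
  have hj₂K : j₂ ≤ K := Nat.lt_succ_iff.1 (Finset.mem_range.1 hj₂)
  rcases lt_or_gt_of_ne hne with h | h
  · exact key h hj₂K hjeq
  · exact key h hj₁K hjeq.symm

/-- **Klurman–Kurlberg 2019, Proposition 2.1 from the finite-order Elliott–Kish theorem.** The
printed proof of the dense half exactly as in `KlurmanKurlberg2019_prop21_of_ElliottKish`, with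
the Elliott–Kish input required only for completely multiplicative unimodular `g` OF FINITE ORDER
(which is what the stripped function `g = ∏_{p ∤ M} f(p)^{v_p}` is: `f` has finite range, so
`f(p)^N = 1` uniformly by `exists_pow_eq_one_of_ne_zero`). [cite: KlurmanKurlberg2019, Prop 2.1] -/
theorem KlurmanKurlberg2019_prop21_of_finiteOrderEK
    (hEK : ∀ a A : ℕ, 0 < a → 0 < A → a ≠ A → ∀ g : ℕ → ℂ,
      (∀ m n : ℕ, 1 ≤ m → 1 ≤ n → g (m * n) = g m * g n) → (∀ n : ℕ, 1 ≤ n → ‖g n‖ = 1) →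
      (∃ m : ℕ, 0 < m ∧ ∀ n : ℕ, 1 ≤ n → g n ^ m = 1) →
      (∀ n : ℕ, 1 ≤ n → g (a * n + 1) = g (A * n + 1)) →
        ∃ Q : ℕ, 0 < Q ∧ ∃ χ : DirichletCharacter ℂ Q, ∀ p : ℕ, p.Prime → ¬ p ∣ Q → g p = χ p)
    (hq : 2 ≤ q) (hf : ∀ m n : ℕ, f (m * n) = f m * f n) (hA : IsAutomaticSeq q f)
    (hfin : {p : ℕ | p.Prime ∧ f p = 0}.Finite) :
    ∃ Q : ℕ, 0 < Q ∧ ∃ χ : DirichletCharacter ℂ Q, ∀ n : ℕ, Nat.Coprime n Q → f n = χ n := by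
  classical
  -- f 1 = 1: otherwise f ≡ 0 and every prime is a zero prime
  have h1 : f 1 = 1 := by
    by_contra h1
    have hf1 : f 1 = 0 := by
      have h := hf 1 1
      rw [one_mul] at h
      have : f 1 * (f 1 - 1) = 0 := by rw [mul_sub, mul_one, ← h, sub_self]
      rcases mul_eq_zero.mp this with h' | h'
      · exact h'
      · exact absurd (sub_eq_zero.mp h') h1
    apply hfin.not_infinite
    have : {p : ℕ | p.Prime ∧ f p = 0} = {p : ℕ | p.Prime} := by
      ext p
      simp only [Set.mem_setOf_eq, and_iff_left_iff_imp]
      intro _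
      have h := hf 1 p
      rw [one_mul, hf1, zero_mul] at h
      exact h
    rw [this]
    exact Nat.infinite_setOf_prime
  -- uniform finite order of the nonzero values
  obtain ⟨N, hN, hfN⟩ := exists_pow_eq_one_of_ne_zero hq hf hA
  -- the product M of the zero primes
  set M : ℕ := ∏ p ∈ hfin.toFinset, p with hM
  have hMpos : 0 < M := Finset.prod_pos (fun p hp => ((Set.Finite.mem_toFinset hfin).mp hp).1.pos)
  have hzeroM : ∀ p : ℕ, p.Prime → f p = 0 → p ∣ M := by
    intro p hp hfp
    exact Finset.dvd_prod_of_mem (fun p : ℕ => p) ((Set.Finite.mem_toFinset hfin).mpr ⟨hp, hfp⟩)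
  -- pigeonhole: two levels with the same kernel element along the class of 1
  have hK : (qKernel q f).Finite := hA
  obtain ⟨j₁, j₂, hj, hjeq⟩ := Set.Finite.exists_lt_map_eq_of_forall_mem
    (f := fun j : ℕ => (fun n : ℕ => f (q ^ (j + 1) * n + 1))) (t := qKernel q f) (by
      intro j
      refine ⟨j + 1, by omega, 1, ?_, rfl⟩
      calc 1 < 2 ^ (j + 1) := Nat.one_lt_two_pow (by omega)
        _ ≤ q ^ (j + 1) := Nat.pow_le_pow_left hq _) hK
  set a : ℕ := q ^ (j₁ + 1) * M with ha
  set A : ℕ := q ^ (j₂ + 1) * M with hA'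
  have hapos : 0 < a := Nat.mul_pos (pow_pos (by omega) _) hMpos
  have hApos : 0 < A := Nat.mul_pos (pow_pos (by omega) _) hMpos
  have haA : a ≠ A := by
    intro h
    have h' : q ^ (j₁ + 1) = q ^ (j₂ + 1) := Nat.eq_of_mul_eq_mul_right hMpos h
    have := Nat.pow_right_injective hq h'
    omega
  -- the stripped function g
  let g : ℕ → ℂ := fun n => n.factorization.prod (fun p e => if p ∣ M then 1 else f p ^ e)
  have hg0 : ∀ p : ℕ, (fun e : ℕ => if p ∣ M then (1 : ℂ) else f p ^ e) 0 = 1 := by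
    intro p; simp
  have hgadd : ∀ p : ℕ, ∀ e₁ e₂ : ℕ, (if p ∣ M then (1 : ℂ) else f p ^ (e₁ + e₂)) =
      (if p ∣ M then (1 : ℂ) else f p ^ e₁) * (if p ∣ M then (1 : ℂ) else f p ^ e₂) := by
    intro p e₁ e₂
    split_ifs <;> simp [pow_add]
  have hgmul : ∀ m n : ℕ, 1 ≤ m → 1 ≤ n → g (m * n) = g m * g n := by
    intro m n hm hn
    simp only [g]
    rw [Nat.factorization_mul (by omega) (by omega), Finsupp.prod_add_index']
    · exact hg0
    · exact hgadd
  have hgprime : ∀ p : ℕ, p.Prime → g p = if p ∣ M then 1 else f p := by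
    intro p hp
    simp only [g]
    rw [Nat.Prime.factorization hp, Finsupp.prod_single_index (hg0 p), pow_one]
  -- finite order of g
  have hgpow : ∀ n : ℕ, 1 ≤ n → g n ^ N = 1 := by
    intro n hn
    simp only [g, Finsupp.prod]
    rw [← Finset.prod_pow]
    refine Finset.prod_eq_one (fun p hp => ?_)
    have hpp : p.Prime := Nat.prime_of_mem_primeFactors (by simpa using hp)
    split_ifs with h
    · exact one_pow _
    · rw [← pow_mul, mul_comm, pow_mul, hfN p (fun h0 => h (hzeroM p hpp h0)), one_pow]
  -- g agrees with f on integers coprime to M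
  have hgf : ∀ n : ℕ, n ≠ 0 → Nat.Coprime n M → g n = f n := by
    intro n hn hcop
    rw [cm_eq_prod_factorization hf h1 hn]
    simp only [g, Finsupp.prod]
    refine Finset.prod_congr rfl (fun p hp => ?_)
    have hpp : p.Prime := Nat.prime_of_mem_primeFactors (by simpa using hp)
    have hpn : p ∣ n := Nat.dvd_of_mem_primeFactors (by simpa using hp)
    have hpM : ¬ p ∣ M :=
      (Nat.Prime.coprime_iff_not_dvd hpp).mp (Nat.Coprime.coprime_dvd_left hpn hcop)
    rw [if_neg hpM]
  -- the Elliott–Kish hypothesis applies to g with (a, A)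
  have hgaA : ∀ n : ℕ, 1 ≤ n → g (a * n + 1) = g (A * n + 1) := by
    intro n hn
    have hc1 : Nat.Coprime (a * n + 1) M := by
      rw [Nat.coprime_comm, Nat.Coprime, Nat.gcd_comm]
      have : Nat.Coprime (a * n + 1) a := by simp
      exact Nat.Coprime.coprime_dvd_right (Dvd.intro_left _ rfl : M ∣ a) this
    have hc2 : Nat.Coprime (A * n + 1) M := by
      rw [Nat.coprime_comm, Nat.Coprime, Nat.gcd_comm]
      have : Nat.Coprime (A * n + 1) A := by simp
      exact Nat.Coprime.coprime_dvd_right (Dvd.intro_left _ rfl : M ∣ A) this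
    rw [hgf _ (by omega) hc1, hgf _ (by omega) hc2, ha, hA']
    have h : f (q ^ (j₁ + 1) * (M * n) + 1) = f (q ^ (j₂ + 1) * (M * n) + 1) :=
      congrFun hjeq (M * n)
    rw [mul_assoc, mul_assoc]
    exact h
  have hgnorm : ∀ n : ℕ, 1 ≤ n → ‖g n‖ = 1 := by
    intro n hn
    simp only [g, Finsupp.prod]
    rw [norm_prod]
    refine Finset.prod_eq_one (fun p hp => ?_)
    have hpp : p.Prime := Nat.prime_of_mem_primeFactors (by simpa using hp)
    split_ifs with h
    · exact norm_one
    · rw [norm_pow, norm_eq_one_of_ne_zero hq hf hA (fun h0 => h (hzeroM p hpp h0)), one_pow]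
  obtain ⟨Q, hQ, χ, hχ⟩ := hEK a A hapos hApos haA g hgmul hgnorm ⟨N, hN, hgpow⟩ hgaA
  -- conclusion with modulus q · Q · M
  have hdvd : Q ∣ q * (Q * M) := ⟨q * M, by ring⟩
  refine ⟨q * (Q * M), Nat.mul_pos (by omega) (Nat.mul_pos hQ hMpos),
    DirichletCharacter.changeLevel hdvd χ, ?_⟩
  intro n hn
  have hn0 : n ≠ 0 := by
    rintro rfl
    have : Nat.gcd 0 (q * (Q * M)) = q * (Q * M) := Nat.gcd_zero_left _
    rw [Nat.Coprime] at hn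
    have hge : 2 ≤ q * (Q * M) := le_trans hq (Nat.le_mul_of_pos_right _ (Nat.mul_pos hQ hMpos))
    omega
  -- f n = χ n
  have hprimes : ∀ p : ℕ, p.Prime → p ∣ n → f p = χ p := by
    intro p hp hpn
    have hpQM : Nat.Coprime p (q * (Q * M)) := Nat.Coprime.coprime_dvd_left hpn hn
    have hpQ : ¬ p ∣ Q :=
      (Nat.Prime.coprime_iff_not_dvd hp).mp (Nat.Coprime.coprime_dvd_right hdvd hpQM)
    have hpM : ¬ p ∣ M :=
      (Nat.Prime.coprime_iff_not_dvd hp).mp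
        (Nat.Coprime.coprime_dvd_right ⟨q * Q, by ring⟩ hpQM)
    rw [← hχ p hp hpQ, hgprime p hp, if_neg hpM]
  have hfχ : f n = χ n := by
    rw [cm_eq_prod_factorization hf h1 hn0]
    conv_rhs => rw [← Nat.prod_factorization_pow_eq_self hn0]
    rw [Finsupp.prod, Finsupp.prod, Nat.cast_prod, map_prod]
    refine Finset.prod_congr rfl (fun p hp => ?_)
    have hpp : p.Prime := Nat.prime_of_mem_primeFactors (by simpa using hp)
    have hpn : p ∣ n := Nat.dvd_of_mem_primeFactors (by simpa using hp)
    rw [Nat.cast_pow, map_pow, hprimes p hpp hpn]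
  rw [hfχ]
  -- χ n = changeLevel χ n for n coprime to the big modulus
  have hcopZ : IsCoprime (n : ℤ) ((q * (Q * M) : ℕ) : ℤ) :=
    Nat.isCoprime_iff_coprime.mpr hn
  have h := DirichletCharacter.changeLevel_eq_cast_of_dvd' χ hdvd hcopZ
  simp only [Int.cast_natCast] at h
  exact h.symm

/-- **Klurman–Kurlberg 2019, Proposition 2.1 (the dense half of Theorem 1.3), PROVED**: if the
completely multiplicative `q`-automatic `f` (`q ≥ 2`) vanishes at only finitely many primes, then
there are `Q > 0` and a Dirichlet character `χ` mod `Q` with `f n = χ n` for all `n` coprime to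
`Q`. The printed proof (pigeonhole in the kernel + Elliott–Kish 2017, Thm 2), with Elliott–Kish's
theorem for finite-order functions proved from Tao's logarithmically averaged Elliott theorem
(`tao_log_averaged_elliott_two_holds`, itself proved in the tree). [cite: KlurmanKurlberg2019, Prop 2.1] -/
theorem KlurmanKurlberg2019_prop21 (hq : 2 ≤ q) (hf : ∀ m n : ℕ, f (m * n) = f m * f n)
    (hA : IsAutomaticSeq q f) (hfin : {p : ℕ | p.Prime ∧ f p = 0}.Finite) :
    ∃ Q : ℕ, 0 < Q ∧ ∃ χ : DirichletCharacter ℂ Q, ∀ n : ℕ, Nat.Coprime n Q → f n = χ n :=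
  KlurmanKurlberg2019_prop21_of_finiteOrderEK
    (ElliottKish2017_thm2_finiteOrder tao_log_averaged_elliott_two_holds) hq hf hA hfin

end DenseUnconditional

/-- **Klurman–Kurlberg 2019, Theorem 1.3, PROVED** (the named fact `KlurmanKurlberg2019_thm13`
discharged): for `q ≥ 2` and a completely multiplicative `f : ℕ → ℂ` with finite `q`-kernel,
there are `Q > 0` and a Dirichlet character `χ` mod `Q` such that either `f n = χ n` for all `n`
coprime to `Q`, or `f p = 0` for all large primes `p`. Assembly `KlurmanKurlberg2019_thm13_of_prop21`
(sparse half `KlurmanKurlberg2019_prop24'` proved elementarily in `MultiplicativeAutomaticProofs`)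
applied to the dense half `KlurmanKurlberg2019_prop21` (Elliott–Kish for finite-order functions +
Tao 2016). Trust base: none beyond Mathlib (axioms `propext`, `Classical.choice`, `Quot.sound`).
[cite: KlurmanKurlberg2019, Thm 1.3 (arXiv:1904.04337 numbering)] -/
theorem KlurmanKurlberg2019_thm13_holds : KlurmanKurlberg2019_thm13 :=
  KlurmanKurlberg2019_thm13_of_prop21 fun _ hq _ hf hA hfin => KlurmanKurlberg2019_prop21 hq hf hA hfin

end Literature.NumberTheory.LFunctions
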